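import Literature.MathematicalPhysics.QuantumFieldTheory.Balaban1983to89.B11Eq88LaplaceH1CurrentLetter
import Literature.MathematicalPhysics.QuantumFieldTheory.Balaban1983to89.B9Eq3126H1kPiOneBlockColumn

/-!
# `Balaban1983to89.B11Eq88LaplaceH1CurrentColumn` — T. Bałaban, *The variational problem and background fields in renormalization group method for lattice
# gauge theories*, Commun. Math. Phys. **102** (1985) 277–309 [Balaban1985Variational] (87)–(88) p. 291 (the row `𝔇*(A′)H*Δ_π A′` of (88)), (27) p. 282, (46)
# p. 285; [Balaban1985BackgroundPropagators] (3.49) p. 399, (3.132)–(3.133) p. 422: **THE LATTICE-FREE `η^d`-WEIGHTED FINE-COLUMN SUM OF THE COMPOSITE CURRENT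
# KERNEL `(Δ̃_{a,k} − Q_k†aQ_k)∘H̃_{1,k}`: `Σ_{b fine} c₀·‖((Δ̃ − Q†aQ)H̃(δ_yZ))(b)‖ ≤ M_φBM_φ′·d·K_d(δ)·‖Z‖`** (`c₀ = η^d`, `c₀·(L^{n+1})^d = (ηL^{n+1})^d = 1`)

WHY (NE9 leaf-01 gen 97, memo §2 (E′)).  The TRANSPOSED row of (88), `𝔇*(A′)H*Δ_π A′ = transCur ρ τ ((HD)′(A′)) (Δπ A′)`, must not be bounded through
`‖Δπ A′‖₍₋₃₎` (ill-posed letter `M_Δ`).  By the pair27-symmetry of `Δ̃ − Q†aQ` (the pattern of `B9Eq3119DeltaPiCarrier.pairSum_currentCLM_comm`) and (68)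
`(HD)′ = H∘𝒞′∘(1 − (HD)′)`, `⟨Δπ A′, H Y⟩ = ⟨(Δπ∘H)Y, A′⟩ = Σ_b η^d τ(((Δ̃ − Q†aQ)H̃Y)(b)·A′(b))`, so what is needed is the `η^d`-weighted `ℓ¹` (column) size
of the SAME composite current — this file — against `‖A′‖₍₁₎` (the weights `(Lʲη)⁻¹ ≤ 1`).  With the row letter `B11Eq88LaplaceH1CurrentNorm` this completes the
lattice-free letters replacing `M_Δ` for both W₂-rows; the re-typed Prop. 4 for `W80` (g98 (E′)(1)) consumes them.

WHAT THIS FILE PROVES (0 def, 0 sorry, axioms standard).  **`exists_colSum_current_laplaceH1_le`** — `∃ (α₁, j₁, B, δ)` BEFORE (K80)'s binder block; then for every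
level profile, derivative letter, coarse bond `y` and `Z ∈ 𝔸`: `Σ_{b fine} c₀·‖((currentCLM … (laplaceAkPi … a − Q_k†∘(aQ_k))) (H̃_{1,k}(δ_yZ)))(b)‖ ≤ M_φ·B·M_φ′·(d·K_d(δ))·‖Z‖`
(the one-block letter of `B11Eq88LaplaceH1CurrentLetter` summed with (B) `sum_fine_exp_block_le`; the block volume `d·(L^{n+1})^d` cancels `c₀ = η^d`).
HONEST SCOPE.  Letter algebra on the cell's MODEL (O-NE9-1; #5 UNRULED); hypotheses as in (K80); NOT the re-typed Prop. 4; NE9 NOT PRINTED ∕ NOT PROVED; spine PROVED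
0∕9; NOT infinite volume, NOT mass gap, NOT Clay.  HONEST DEPENDENCY: continuum YM on T⁴ ⇐ BetaPertH ∧ nine spine estimates (0/9 proved); BetaPertH ⇐ (D1) ∧ (D4) ∧
CAP+tail; G-an2-4 gates asym, D1 and NE2/3/4.  NEW file; nothing modified.  Net new unproved facts: 0.
-/

noncomputable section

set_option autoImplicit false

open scoped InnerProductSpace ComplexConjugate BigOperators

namespace Literature.MathematicalPhysics.QuantumFieldTheory.Balaban1983to89.B11Eq88LaplaceH1CurrentColumn



open B4Sect5Torus (TSite tdist tdist_nonneg tdist_symm tdist_self tdist_triangle torusSum_le)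
open B4Sect5Proof (latticeConst latticeConst_nonneg)
open B9SectCLatticeCarrier (Bond DirPair bpos btgt shift unshift)
open B9Eq311L2Pairing (WL2)
open B9Eq319QprimeTorus (fineP blockCoord)
open B7Prop1Explicit (U1 Wcx boxVec)
open B11Eq103H1Complex (SiteL2K BondL2K greenK covDerivL2K covDivL2K G1LatticeK KinvLatticeK H1LatticeK H1LatticeK_eq)
open B9Eq310DeltaPrime (plaqHolU)
open B9Eq310HessianOperator (adTransportW hessOp)
open B9Eq310HessianHermitian (adTransportW_adjoint)
open B9Eq315QTorus (perCfg cornerSite)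
open B9Eq315QTower (towerP UlevOf)
open B9Eq316TowerFlatIsOneStep (towerP_eq_fineP_pow siteCast)
open B9Eq326OperatorTower (QprimeTowerW QkW RofUk laplaceAk G1k)
open B9Eq324DeltaPrimeATower (laplacePrimeAk GpOfUk)
open B9Eq33CovDerivLocalLetterTower (tdist_bigBlock_bpos_btgt_le_one)
open B9Eq3117GaugeModeStencilLettersTower (local_hessOp_covDerivL2K_tower local_covDivL2K_hessOp_tower)
open B9Eq3132QGtildeQInvLetterClosed (exists_local_letter_KinvLatticeKPi)
open B9Eq3132QadjKinvPiSupRowClosed (exists_local_letter_QadjKinvLatticeKPi)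
open B11Eq88LaplaceH1CurrentLetter (exists_oneBlock_letter_laplaceH1_current)
open B9Eq3126H1kPiOneBlockColumn (sum_fine_exp_block_le)
open B11Eq88LaplaceH1Identity (laplaceALatticeK_H1LatticeK)
open B9Eq3119DeltaPiCarrier (currentCLM equiv_currentCLM)
open B11Eq103H1Complex (H1LatticeCLM H1CLM_apply funEquiv funEquiv_symm_apply Q_H1LatticeK)
open B11Eq90V0primeCurrent (flat115 flat115_apply)
open B11Eq115Space
open B9Eq3119DeltaPiTower (piOfUk laplaceAkPi)

variable {d : ℕ} (hd : 1 ≤ d) (L : ℕ) [NeZero L] (hL : 1 ≤ L) (hL3 : 3 ≤ L)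
  {𝔸 : Type*} [NormedRing 𝔸] [NormedAlgebra ℂ 𝔸] [CompleteSpace 𝔸] [NormOneClass 𝔸] [StarRing 𝔸] [NormedStarGroup 𝔸] [StarModule ℂ 𝔸]
  {W : Type*} [NormedAddCommGroup W] [InnerProductSpace ℂ W] [FiniteDimensional ℂ W] (φ : W ≃ₗ[ℂ] 𝔸)
  {Mφ Mφ' : ℝ} (hMφ : 0 ≤ Mφ) (hMφ' : 0 ≤ Mφ') (hφ : ∀ w, ‖φ w‖ ≤ Mφ * ‖w‖) (hφ' : ∀ X, ‖φ.symm X‖ ≤ Mφ' * ‖X‖) (hstar : ∀ X : 𝔸, ‖star X‖ ≤ ‖X‖)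
  {a : ℝ} (ha : 0 < a) {a' : ℝ} (ha' : 0 < a') {ϱ : ℝ} (hϱ0 : 0 ≤ ϱ) (hϱ1 : ϱ < 1)
  (τ : 𝔸 →ₗ[ℂ] ℂ) {Cτ : ℝ} (hτ : ∀ X, ‖τ X‖ ≤ Cτ * ‖X‖) (hCτ : 0 ≤ Cτ) {Mτ : ℝ} (hτm : ∀ X Y : 𝔸, ‖τ (X * Y)‖ ≤ Mτ * ‖X‖ * ‖Y‖) (hMτ : 0 ≤ Mτ)
  {ρw : ℝ} (hρw : 0 ≤ ρw)
  (hτ₁ : ∀ X : 𝔸, τ (star X) = conj (τ X)) (hτ₂ : ∀ X Y : 𝔸, τ (X * Y) = τ (Y * X)) (hφτ : ∀ X Y : 𝔸, ⟪φ.symm X, φ.symm Y⟫_ℂ = τ (star X * Y))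
  (AQ : ℝ)

open B9Eq326G1SupRowOfLetters (letter_comp letter_mono)
open B9Eq3126H1SupRowOfLetters (letter_of_range local_letter_H1_of_letters)
open B9Eq349BlockDistanceWeight (tdist_shift_le_one)
open B9Eq315QkSingleBondLetter (norm_adjoint_QkW_apply_le_local_sharp)

set_option maxRecDepth 8192 in
set_option maxHeartbeats 800000 in -- (K80)'s ≈ 50-binder block + the carrier reading
include hd hL hL3 hMφ hMφ' hφ hφ' hstar ha ha' hϱ0 hϱ1 hτ hCτ hτm hMτ hρw hτ₁ hτ₂ hφτ in
/-- **`Σ_{b fine} c₀·‖((Δ̃_{a,k} − Q_k†aQ_k)H̃_{1,k}(δ_yZ))(b)‖ ≤ M_φBM_φ′·d·K_d(δ)·‖Z‖` WITH `(α₁, j₁, B, δ)` BEFORE THE LATTICE** — the fine-column sum of the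
one-block letter; `c₀·d·(L^{n+1})^d·K_d(δ) = d·K_d(δ)` since `c₀(L^{n+1})^d = (ηL^{n+1})^d = 1`.
[cite: Balaban1985Variational, (87)–(88) p.291, (27) p.282, (46) p.285; Balaban1985BackgroundPropagators, (3.49) p.399, (3.132)–(3.133) p.422] -/
theorem exists_colSum_current_laplaceH1_le :
    ∃ α₁ j₁ B δ : ℝ, 0 < α₁ ∧ 0 < j₁ ∧ 0 ≤ B ∧ 0 < δ ∧
      ∀ (n : ℕ) (η : ℝ) (_hηL : η * (L : ℝ) ^ (n + 1) = 1) (c₀ c₁ : ℝ) [Fact (0 < c₀)] [Fact (0 < c₁)]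
        (_hw : c₀ * ((L : ℝ) ^ (n + 1)) ^ d = c₁) (_hρ : |η| ^ d / c₀ ≤ ρw) (m : Fin d → ℕ) [∀ i, NeZero (m i)] (_hm : ∀ i, 1 ≤ m i)
        (U : Bond d (towerP L m (n + 1)) → 𝔸ˣ) (αU : ℕ → ℝ) (_hα0 : ∀ j, 0 ≤ αU j) (hα1 : ∀ j, αU j ≤ 1 / 64)
        (hαL : ∀ j, 50 * (d + 1) * αU j * (L : ℝ) ^ d ≤ 1 / 2)
        (hU1 : ∀ (j : ℕ) (x : B7Prop1Explicit.Site d) (k : Fin d), perCfg (towerP L m (j + 1)) (UlevOf L m (n + 1) U j) x k ∈ U1 𝔸)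
        (hreg : ∀ (j : ℕ) (y : TSite d (towerP L m j)) (k : Fin d) (ρ' : Fin d → Fin L),
          ‖((Wcx L (perCfg (towerP L m (j + 1)) (UlevOf L m (n + 1) U j)) (cornerSite L y) k (boxVec L ρ') : 𝔸ˣ) : 𝔸) - 1‖ ≤ αU j)
        (εU : ℕ → ℝ) (_hεU : ∀ j, 0 ≤ εU j) (_hUε : ∀ (j : ℕ) (b : Bond d (towerP L m (j + 1))), ‖(UlevOf L m (n + 1) U j b : 𝔸) - 1‖ ≤ εU j)
        (_hLb : ∀ (j : ℕ) (b : Bond d (towerP L m (j + 1))), UlevOf L m (n + 1) U j b ∈ U1 𝔸)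
        (α : ℝ) (_hα : 0 ≤ α) (_hαle : α ≤ α₁)
        (hUst : ∀ b, star (U b : 𝔸) = (((U b)⁻¹ : 𝔸ˣ) : 𝔸)) (_hUb : ∀ b, U b ∈ U1 𝔸) (_hUη : ∀ b, ‖(U b : 𝔸) - 1‖ ≤ α * η)
        (_hpl : ∀ p : B9SectCLatticeCarrier.Plaq d (towerP L m (n + 1)), ‖(plaqHolU U p : 𝔸) - 1‖ ≤ α * η ^ 2)
        (_hUgrad : ∀ (x : TSite d (towerP L m (n + 1))) (μ : Fin d), ‖(U (x, μ) : 𝔸) - U (unshift μ x, μ)‖ ≤ α * η ^ 2)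
        (_hRlev : ∀ (j : ℕ) (b : Bond d (towerP L m (j + 1))) (w : W), ‖adTransportW φ (UlevOf L m (n + 1) U j) b w‖ ≤ ‖w‖)
        (_hεg : ∀ j < n + 1, εU j ≤ α * ϱ ^ j) (_hAQ : ∑ j ∈ Finset.range (n + 1), αU j ≤ AQ)
        (hpos' : ∀ x : SiteL2K ℂ d (towerP L m (n + 1)) c₀ W, x ≠ 0 → 0 < RCLike.re ⟪x, laplacePrimeAk L m n φ η U a' (c₁ := c₁) x⟫_ℂ)
        (hpos : ∀ x : BondL2K ℂ d (towerP L m (n + 1)) c₀ W, x ≠ 0 →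
          0 < RCLike.re ⟪x, laplaceAk L m n φ η U hL αU hα1 hU1 hreg τ (c₀ := c₀) (c₁ := c₁) a x⟫_ℂ)
        (_hc₀η : c₀ = η ^ d) (j₀ : ℝ) (_hJ : ∀ μ y, ‖B9Eq39Adjoint.J (fun μ => B9Eq33CovDerivVector.shiftEquiv μ) (fun μ y => U (y, μ)) η μ y‖ ≤ j₀) (_hj : j₀ ≤ j₁)
        (hposπ : ∀ x : BondL2K ℂ d (towerP L m (n + 1)) c₀ W, x ≠ 0 →
          0 < RCLike.re ⟪x, laplaceAkPi L m n φ τ η U a' hpos' hL αU hα1 hU1 hreg (c₁ := c₁) a x⟫_ℂ)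
        (hQ : Function.Surjective (QkW L m n φ U hL αU hα1 hU1 hreg (c₀ := c₀) (c₁ := c₁)))
        [FiniteDimensional ℂ 𝔸] (lev₀ : Bond d (towerP L m (n + 1)) → ℕ) {κ' : Type*} [Fintype κ'] (lev₁ : κ' → ℕ)
        (Dc : (Bond d (towerP L m (n + 1)) → 𝔸) →ₗ[ℂ] (κ' → 𝔸)) (levB : Bond d m → ℕ) [Fact (0 < (L : ℝ))] [Fact (0 < η)]
        (y : Bond d m) (Z : 𝔸),
        ∑ b : Bond d (towerP L m (n + 1)), c₀ * ‖NegSup.equiv (levWeight (L : ℝ) η lev₀ 3) 𝔸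
            (currentCLM φ lev₁ Dc
              (laplaceAkPi L m n φ τ η U a' hpos' hL αU hα1 hU1 hreg (c₁ := c₁) a
                - LinearMap.adjoint (QkW L m n φ U hL αU hα1 hU1 hreg (c₀ := c₀) (c₁ := c₁)) ∘ₗ
                    ((a : ℂ) • QkW L m n φ U hL αU hα1 hU1 hreg (c₀ := c₀) (c₁ := c₁)))
              (H1LatticeCLM (L := (L : ℝ)) (η := η) (lev₀ := lev₀) (levB := levB) φ hposπ hQ lev₁ Dc
                ((NegSup.equiv (levWeight (L : ℝ) η levB 0) 𝔸).symm (Pi.single y Z)))) b‖ ≤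
          Mφ * B * Mφ' * (d * latticeConst d δ) * ‖Z‖ := by
  obtain ⟨α₁, j₁, B, δ, hα₁, hj₁, hB, hδ, HB⟩ :=
    exists_oneBlock_letter_laplaceH1_current hd L hL hL3 φ hMφ hMφ' hφ hφ' hstar ha ha' hϱ0 hϱ1 τ hτ hCτ hτm hMτ hρw hτ₁ hτ₂ hφτ AQ
  refine ⟨α₁, j₁, B, δ, hα₁, hj₁, hB, hδ, ?_⟩
  intro n η hηL c₀ c₁ _ _ hw hρ m _ hm U αU hα0 hα1 hαL hU1 hreg εU hεU hUε hLb α hα hαle hUst hUb hUη hpl hUgrad hRlev hεg hAQ hpos' hpos hc₀η j₀ hJ hj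
    hposπ hQ _ lev₀ κ' _ lev₁ Dc levB _ _ y Z
  have hc₀ : (0 : ℝ) < c₀ := Fact.out
  -- the «block volume» identity `c₀·(L^{n+1})^d = c₁ = (ηL^{n+1})^d = 1`
  have hc₁ : c₀ * ((L : ℝ) ^ (n + 1)) ^ d = 1 := by
    rw [hc₀η, ← mul_pow, hηL, one_pow]
  calc ∑ b : Bond d (towerP L m (n + 1)), c₀ * ‖NegSup.equiv (levWeight (L : ℝ) η lev₀ 3) 𝔸
            (currentCLM φ lev₁ Dc
              (laplaceAkPi L m n φ τ η U a' hpos' hL αU hα1 hU1 hreg (c₁ := c₁) a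
                - LinearMap.adjoint (QkW L m n φ U hL αU hα1 hU1 hreg (c₀ := c₀) (c₁ := c₁)) ∘ₗ
                    ((a : ℂ) • QkW L m n φ U hL αU hα1 hU1 hreg (c₀ := c₀) (c₁ := c₁)))
              (H1LatticeCLM (L := (L : ℝ)) (η := η) (lev₀ := lev₀) (levB := levB) φ hposπ hQ lev₁ Dc
                ((NegSup.equiv (levWeight (L : ℝ) η levB 0) 𝔸).symm (Pi.single y Z)))) b‖
      ≤ ∑ b : Bond d (towerP L m (n + 1)), c₀ * (Mφ * B * Mφ' * Real.exp (-(δ * tdist m (blockCoord (L ^ (n + 1)) m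
            (siteCast (towerP_eq_fineP_pow L m (n + 1)) (bpos b))) (bpos y))) * ‖Z‖) :=
        Finset.sum_le_sum fun b _ => mul_le_mul_of_nonneg_left
          (HB n η hηL c₀ c₁ hw hρ m hm U αU hα0 hα1 hαL hU1 hreg εU hεU hUε hLb α hα hαle hUst hUb hUη hpl hUgrad hRlev hεg hAQ hpos' hpos hc₀η
            j₀ hJ hj hposπ hQ lev₀ lev₁ Dc levB y Z b) hc₀.le
    _ = c₀ * (Mφ * B * Mφ' * ‖Z‖) * ∑ b : Bond d (towerP L m (n + 1)), Real.exp (-(δ * tdist m (blockCoord (L ^ (n + 1)) m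
            (siteCast (towerP_eq_fineP_pow L m (n + 1)) (bpos b))) (bpos y))) := by
        rw [Finset.mul_sum]
        exact Finset.sum_congr rfl fun b _ => by ring
    _ ≤ c₀ * (Mφ * B * Mφ' * ‖Z‖) * (d * ((L : ℝ) ^ (n + 1)) ^ d * latticeConst d δ) :=
        mul_le_mul_of_nonneg_left (sum_fine_exp_block_le L n m hm hδ (bpos y)) (by positivity)
    _ = (c₀ * ((L : ℝ) ^ (n + 1)) ^ d) * (Mφ * B * Mφ' * (d * latticeConst d δ) * ‖Z‖) := by ring
    _ = Mφ * B * Mφ' * (d * latticeConst d δ) * ‖Z‖ := by rw [hc₁, one_mul]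

end Literature.MathematicalPhysics.QuantumFieldTheory.Balaban1983to89.B11Eq88LaplaceH1CurrentColumn

end
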